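import Summits.ValiantsHypothesis.ValiantsHypothesis.Theorems.KPlusLogSqLawTropicalBScaleCarries
import Summits.ValiantsHypothesis.ValiantsHypothesis.Theorems.KPlusLogSqLawTropicalBSeparatedTowerTB

/-!
# Route «KPlusLogSqLaw», crux `TropicalB` (stmt-ValiantsHypothesis-19771) — the scale-carry law in the crux's own shape:
# pure `c`-lex exponents + steps re-classing `≤ c` columns ⇒ `n ≤ 2^((c+1)·(K + ⌊log₂ m⌋²))`

HONEST FRAMING.  Helper toward the registered stubs `stub_tropThin` / `stub_tropFat` of `Cruxes/TropicalB/Lines/birth.lean` (crux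
`Summit.ValiantsHypothesis.ValiantsHypothesis.Theses.KPlusLogSqLaw.TropicalB`, item `stmt-ValiantsHypothesis-19771`, route `KPlusLogSqLaw`;
cell `pub-symmetroid`, seat val-sym-trop-p1 g10, 2026-08-27; `--supports … --as helper`).  Arithmetic repackaging of part 2's
`ScaleCarries.chain_le_pureLex_of_shortSteps` (`n ≤ m·(c+1)^(K−1)`) as the inequality of `TropicalB` with the constant `C = c + 1`, for the
CHAIN-LEVEL sector «exponents `c`-lacunary in class order (`c·d l < d l'` for `l < l'`, `1 ≤ c`) and every step of the chain re-classes at most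
`c` columns».  A sector statement under the crux's own chain hypotheses (strictly increasing integer slopes, unique optima, distinct consecutive
terms — implied by alternating signs); nothing here bounds `TropicalB` for general designs or chains, nothing on `WeakLifting`, the doors,
`MatrixDescartes` (stmt-ValiantsHypothesis-18050) or VP ≠ VNP.

* `mul_succ_pow_le_two_pow` — `m·(c+1)^(K−1) ≤ 2^((c+1)·(K + ⌊log₂ m⌋²))` for `1 ≤ c`.
* `tropicalB_shape_pureLex_of_shortSteps` — the sector law in the crux's shape (distinct consecutive terms);
  `tropicalB_shape_pureLex_of_shortSteps_alt` — the same from alternating signs (`termSign` products negative; consecutive terms are then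
  distinct by the tree's `SeparatedLex.ne_of_termSign_mul_neg`).
[arithmetic; this file]
-/

set_option linter.dupNamespace false
set_option autoImplicit false

namespace Summit.ValiantsHypothesis.ValiantsHypothesis.Theorems.KPlusLogSqLaw.ScaleCarries

open Summit.ValiantsHypothesis.ValiantsHypothesis.Theorems.MatrixDescartes.Negative
open scoped BigOperators
open Finset

/-- arithmetic: `m·(c+1)^(K−1) ≤ 2^((c+1)·(K + ⌊log₂ m⌋²))` (`1 ≤ c`). [folklore] -/
theorem mul_succ_pow_le_two_pow (m c K : ℕ) (hc : 1 ≤ c) :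
    m * (c + 1) ^ (K - 1) ≤ 2 ^ ((c + 1) * (K + Nat.log 2 m ^ 2)) := by
  set L := Nat.log 2 m with hL
  have h1 : (c + 1) ^ (K - 1) ≤ 2 ^ (c * (K - 1)) := by
    rw [pow_mul]
    exact Nat.pow_le_pow_left (Nat.lt_two_pow_self) _
  -- `m ≤ 2^(L² + 1)` and, for `m ≥ 2`, `m ≤ 2^(2L²)`
  have hm1 : m ≤ 2 ^ (L + 1) := (hL ▸ Nat.lt_pow_succ_log_self (by norm_num) m).le
  have hLL : L ≤ L ^ 2 := Nat.le_self_pow two_ne_zero L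
  rcases Nat.eq_zero_or_pos K with rfl | hK
  · -- K = 0: the claim is `m ≤ 2^((c+1)·L²)`
    simp only [Nat.zero_sub, pow_zero, mul_one, zero_add]
    rcases Nat.lt_or_ge m 2 with hm | hm
    · exact (show m ≤ 1 by omega).trans Nat.one_le_two_pow
    · have hLpos : 1 ≤ L := by rw [hL]; exact Nat.log_pos (by norm_num) hm
      calc m ≤ 2 ^ (L + 1) := hm1
        _ ≤ 2 ^ ((c + 1) * L ^ 2) := Nat.pow_le_pow_right (by norm_num) (by nlinarith)
  · obtain ⟨K', rfl⟩ : ∃ K', K = K' + 1 := ⟨K - 1, by omega⟩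
    rw [Nat.add_sub_cancel] at h1 ⊢
    calc m * (c + 1) ^ K' ≤ 2 ^ (L + 1) * 2 ^ (c * K') := Nat.mul_le_mul hm1 h1
      _ = 2 ^ (L + 1 + c * K') := (pow_add _ _ _).symm
      _ ≤ 2 ^ ((c + 1) * (K' + 1 + L ^ 2)) :=
          Nat.pow_le_pow_right (by norm_num) (by nlinarith [Nat.zero_le (c * L ^ 2)])

variable {m K : ℕ}

/-- **THE SCALE-CARRY LAW IN THE CRUX'S SHAPE (sector).**  If the exponents are `c`-lacunary in class order (`c·d l < d l'` for `l < l'`,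
`1 ≤ c`), then every chain of unique optima at strictly increasing integer slopes with distinct consecutive terms in which every step re-classes
at most `c` columns satisfies `n ≤ 2^((c+1)·(K + ⌊log₂ m⌋²))` — `TropicalB`'s inequality with `C = c + 1` on this chain-level sector, at every
format. [this file] -/
theorem tropicalB_shape_pureLex_of_shortSteps (c : ℕ) (hc : 1 ≤ c) (d : Fin K → ℕ)
    (hlex : ∀ l l' : Fin K, l < l' → c * d l < d l')
    (v ε : Fin m → Fin m → Fin K → ℤ) {n : ℕ} (θ : Fin (n + 1) → ℤ)
    (p : Fin (n + 1) → Equiv.Perm (Fin m) × (Fin m → Fin K))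
    (hθ : StrictMono θ) (hdom : ∀ k, IsDominant d v ε (θ k) (p k)) (hne : ∀ k : Fin n, p k.castSucc ≠ p k.succ)
    (hshort : ∀ k : Fin n, (univ.filter fun b => (p k.succ).2 b ≠ (p k.castSucc).2 b).card ≤ c) :
    n ≤ 2 ^ ((c + 1) * (K + Nat.log 2 m ^ 2)) :=
  (chain_le_pureLex_of_shortSteps c hc d hlex v ε θ p hθ hdom hne hshort).trans (mul_succ_pow_le_two_pow m c K hc)

/-- the same sector law under ALTERNATING SIGNS (the hypothesis list of `TropicalB` / `TropRootLawAt`). [this file] -/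
theorem tropicalB_shape_pureLex_of_shortSteps_alt (c : ℕ) (hc : 1 ≤ c) (d : Fin K → ℕ)
    (hlex : ∀ l l' : Fin K, l < l' → c * d l < d l')
    (v ε : Fin m → Fin m → Fin K → ℤ) {n : ℕ} (θ : Fin (n + 1) → ℤ)
    (p : Fin (n + 1) → Equiv.Perm (Fin m) × (Fin m → Fin K))
    (hθ : StrictMono θ) (hdom : ∀ k, IsDominant d v ε (θ k) (p k))
    (halt : ∀ k : Fin n, termSign ε (p k.castSucc) * termSign ε (p k.succ) < 0)
    (hshort : ∀ k : Fin n, (univ.filter fun b => (p k.succ).2 b ≠ (p k.castSucc).2 b).card ≤ c) :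
    n ≤ 2 ^ ((c + 1) * (K + Nat.log 2 m ^ 2)) :=
  tropicalB_shape_pureLex_of_shortSteps c hc d hlex v ε θ p hθ hdom (fun k => SeparatedLex.ne_of_termSign_mul_neg ε (halt k)) hshort

end Summit.ValiantsHypothesis.ValiantsHypothesis.Theorems.KPlusLogSqLaw.ScaleCarries
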